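import Summits.BirchSwinnertonDyer.Rank1Residual.X11b.KolyvaginIndexRecordsKitThree
import HarnessLib

/-!
# BSD rank-≤1 residual cell, lane class X4 (ADDITIVE at `3`, `ρ̄_{E,3}` onto), BOTH ranks, KOLY-shaped (`3 ∤ #E(ℚ)_tors·∏c·#Ш_an`): `BSD(E,3)`
# PER CELL from PUBLISHED theorems + Kolyvagin's HEEGNER-INDEX certificate `3 ∤ [E(K):ℤy_K]` (two engines) through the unit's GEN 35 kit
# `X11b.bsdp_three_of_kolyvaginIndex_of_irr_of_order`, `ρ̄_{E,3}` onto IN THE KERNEL — records 01 (x11c GEN 36 «J1-REMAINDER / KOLY-R»)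

HONEST FRAMING (cell `b2b-bsdres-*`, verbatim): prove what is provable now; shrink each hard class to its core with data; no claim beyond
stated classes; COMBINATION classes deleted from PUBLISHED theorems only, CONSTRUCTION-shaped remainder typed; this is not "finishing BSD".
X4 / X11b (and X11 ∧ r = 1 ∧ p = 3) stay CONSTRUCTION-SHAPED; everything here is PER CELL; no lane verdict is changed; NO named fact is
introduced (debt 0) and NO definition; nothing is booked by this file (bookings are referee A's, pub-bsdpct); Cremona's numbers (`r_an`,
`#Ш_an`, models, generators, `∏ c_ℓ`, torsion, optimality / Manin codes, the galrep datum) and the Kurihara lane's per-prime tables are INPUTS.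

Unit `b2b-bsdres-x11c`, GEN 36 (prover-b2b-bsdres-x11c-g36-0), move «J1-REMAINDER / KOLY-R». POPULATION (`HOME/b2b-bsdres-x11c/gen36/pop/`:
`census36.py` over referee A's ROUND 983 state of record × the Kurihara lane's sweep records × Cremona, then `build_pop36.py`): EVERY live
residue cell on the Kolyvagin / Jetchev road classes (X4, X7, X8, X11a, X11b), BOTH ranks, odd `p`, whose shape is KOLY (`ρ̄_{E,p}` onto,
`p ∤ #E(ℚ)_tors·∏c·#Ш_an`: 30 cells) or J1 (onto, `p ∤ #E(ℚ)_tors·#Ш_an`, exactly ONE prime `q ∣ N` with `p ∣ c_q`: 171 cells; the two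
J1 cells whose carrier is an ADDITIVE `p` have no door and are excluded) — 199 cells on 191 classes (188 of them with this cell as their ONLY
open cell): 82 rank-one `(3, X11b)`, 59 `(5, X4)` + 2 `(7, X4)` (rank one 19 / rank zero 42), 26 `(3, X4)` J1 (1 / 25), 20 `(3, X4)` KOLY
(6 / 14), 10 KOLY at `p ≥ 5`. The lane never certified them: at rank one its Heegner fields (`|D| ≤ 1511`) read `ord_p [E(K):ℤy_K] = w + 1`
or found no admissible field; at rank zero (additive `p`) no Heegner-index line was ever run. THIS UNIT ran the cell's engines VERBATIM in
DEEPER fields: engine 1 = gen 3 `engine1_cha1b/main.py` = x9-g7 `jobD1b.py` (cypari2, sha256 `69e29ec7…`; rank-one mode: Cremona's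
generator, `hy = L'(E,1)·L(E^D,1)·√|D|/(4·Area)`, `m = √(4·hy/ĥ(P))`; rank-zero mode: the rank-one twist `F = E^D`, a point `x ∈ F(ℚ)` by
`ellrank`, saturated, `hy = L(E,1)·L'(F,1)·√|D|/(4·Area)`, `m = √(4·hy/ĥ(x))` — Miller 2011 Thm. 4.1 / Cor. 4.8; `NDISC 16`, `DBOUND 6000`);
engine 2 = gen 3 `run_cert.py` (`1b54bb20…`) + `e2lib.py` + `tate_stdlib.py` (stdlib re-implementation: `m`, `ord_p m` must be EQUAL,
discrete checks); twist values = additive-p1 `twistvals/main.py` (`e501b988…`). Kit jobs: see HOME/b2b-bsdres-x11c/gen36/harvest/JOBS-gen36.txt. Evidence `HOME/b2b-bsdres-x11c/gen36/`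
(POP36.md, ROWS36-TABLE.md, harvest outputs with inputs.sha256, SHA256SUMS); REPORT.md §45.

THE ROAD (the unit's GEN 26/27/32/35 Kolyvagin route, class-agnostic, at `p = 3`; referee A booked its X11b rows at pub-bsdpct ROUNDS
958 / 961 in the KOLYD-r1 grammar): Kolyvagin's theorem as PRINTED by McCallum (LMS LN 153 (1991) §1, p. 296) / Gross (ibid., Prop. 2.1 (2))
— tree named facts `kolyvagin`, `Kolyvagin1990_padicValNat_card_sha_le` (registry A20; «p = 3 allowed as printed»; NOTHING about the
reduction of `E` at `p`, NOTHING about the rank beyond `y_K` of infinite order): `3 ∤ [E(K):ℤy_K]` ⇒ `Ш(E/K)[3] = 0` ⇒ `Ш(E/ℚ)[3] = 0`,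
and with `ord₃ #Ш_an = 0` Miller's `BSD(E,3)` (`Typed.bsdp_of_kolyvagin_of_not_dvd_index`, `r_an ≤ 1`).
IN THE KERNEL per cell: global minimality of Cremona's model by the factored Kraus criterion
`Supersingular.isGloballyMinimal_of_krausCriterion₃_factored` on the COMPLETE factorisation of `|Δ|`; `ρ̄_{E,3}` ONTO by Serre's Prop. 15
from TWO witness primes (`X² − a_ℓX + ℓ` root-free over `𝔽₃`; `ℓ ≡ 1 (mod 3)`, `a_ℓ ≡ 2 (mod 3)`, `9 ∤ #Ẽ(𝔽_ℓ)`), schema point counts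
(`Supersingular.surj_three_of_ainvs_of_irr_of_order`). DISPLAYED (binders, LETTER FOR LETTER the tuple of the unit's
`X11b.bsdp_k<label>_3` records `X11b/KolyvaginIndexRecordsX11bRankOneThree01–80`): `hGZK`, `hKo` / `hB`, the Heegner datum (`K`,
level `N`, `P` of infinite order, `3 ∤ [E(K):ℤP]` — THIS UNIT's two-engine datum, quoted per docstring, NOT re-computed here), `r_an ≤ 1`,
`#Ш_an = q` with `ord₃ q = 0`.
What a record is worth is the referee's call (EVIDENCE-grade certificate under displayed binders, as every Heegner-index record of the
cell). Cells in this file: `103581a1`@3, `365490v1`@3, `407358v1`@3, `407682h1`@3, `427635c1`@3, `491040bf1`@3, `194400cd1`@3.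

References: D. Jetchev, Compos. Math. 144 (2008) Thm. 1.4, Cor. 1.5 [Jetchev2008]; W. McCallum, LMS LN 153 (1991) §1, Cor. 5.6
[McCallumLMS1991]; B. H. Gross, LMS LN 153 (1991) Prop. 2.1 [GrossLMS1991]; V. A. Kolyvagin (1990) [KolyvaginEulerSystems1990];
J.-P. Serre, Invent. Math. 15 (1972) §2.4 Prop. 15, §2.8 Prop. 19 [Serre1972]; J.-P. Serre, *Abelian ℓ-adic representations* IV-23
[SerreAbelianLadic1968]; B. H. Gross, D. Zagier, Invent. Math. 84 (1986) [GrossZagier1986]; R. L. Miller, LMS J. Comput. Math. 14 (2011)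
Thm. 4.1, Cor. 4.8, Def. 1.1 [Miller2011LMS]; C. Wuthrich, Doc. Math. 19 (2014) Lemma 20 [Wuthrich2014]; J. H. Silverman, *AEC* (2009)
VII.1, VII.5 [SilvermanAEC2009], *ATAEC* (1994) IV.9.4 [SilvermanATAEC1994]; A. Kraus, Acta Arith. 54 (1989) [Kraus1989]; Cremona's
tables [Cremona2006].
-/

set_option autoImplicit false

noncomputable section

open scoped Classical

open WeierstrassCurve Literature.NumberTheory.EllipticCurves
  Literature.NumberTheory.EllipticCurves.Rank1Residual
  Literature.NumberTheory.EllipticCurves.Rank1Residual.Typed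
  Literature.NumberTheory.EllipticCurves.Rank1Residual.X11RankOneCertificates
  Summit.BirchSwinnertonDyer.BirchSwinnertonDyer.Rank1Residual.IntModel
  Summit.BirchSwinnertonDyer.BirchSwinnertonDyer.Rank1Residual.X11RankOne

namespace Summit.BirchSwinnertonDyer.Rank1Residual.X4

/-- **`BSD(E,3)` for `103581a1`** (cell `(103581a1, 3)`, class X4, rank 1; KOLYD grammar key `KOLY:103581a1@3`); `N = 103581 = 3^2·17·677`, additive
`III` at `3`, `r_an = 1`, `#E(ℚ)_tors = 1`, `∏c = 2`, `#Ш_an = 1`, Cremona galrep: no code at this prime (`ρ̄_{E,3}` onto); `|Δ| = ∏` over `[(3, 3),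
(17, 1), (677, 1)]` (factored Kraus criterion, every disjunct decided). KOLY-shaped: `3 ∤ #E(ℚ)_tors·∏c·#Ш_an`; door
`X11b.bsdp_three_of_kolyvaginIndex_of_irr_of_order` (the unit's GEN 35 kit, class-agnostic: Kolyvagin as printed, `3 ∤ [E(K):ℤy_K]` ⇒ `Ш(E/ℚ)[3] =
0`); displayed certificate line `hI : ¬ 3 ∣ [E(K):ℤP]`. Serre Prop-15 witnesses mod `3`: `(ℓ, #Ẽ(𝔽_ℓ))` = `(7, 11)` (`X² − aX + ℓ` root-free over
`𝔽₃`), `(73, 75)` (`ℓ ≡ 1`, `a ≡ 2 (mod 3)`, `9 ∤ #Ẽ`). Kurihara lane note of record: «additive p, r=1; index bound 2». State of record (referee A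
ROUND 983, `scratchA_A_state_after_x4gh_add3_onA2R977_fold.pkl`): class `residue`, 1 open cell(s), register empty. Other engine-1 fields tried (`D`:
`m` (`ord_3 m`)): `-35`: `m = 12` (`ord = 1`); `-59`: `m = 12` (`ord = 1`); `-152`: `m = 24` (`ord = 1`); `-155`: `m = 36` (`ord = 2`). THIS UNIT'S
DATUM (displayed, NOT re-computed here): DEEP FIELD `K = ℚ(√-191)` (`191` = prime): **`m = [E(K):ℤy_K] = 52`, `ord_3 m = 0`** (`ρ = m²/4`, `L'(E,1)
= 7.2834417495`, `L(E^D,1) = 8.7708626382`, `ĥ(P) = 2.1245683649`; Cremona's generator) — engine 1 j293234 = engine 2 j294330: `m = 52` EQUAL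
(FAIL:p2_not_div_N,lattice_j_selfcheck, dev ≤ 1.3e-14) (engine 2's period-lattice self-check restored by the PARI third check j295414: dev_j ≤
1.6673727307828106009 E-76); twist `E^D` (j294332): `N = 3778738461`, `#tors·∏c·#Ш_an = 1·4·169`, `ord_3 #Ш_an(E^D) = 0`, `ord_3 ∏c(E^D) = 0`
(BSD-consistent). CONDITIONAL on every binder; per cell; nothing booked by this file.
[cite: McCallumLMS1991, §1 Theorem (Kolyvagin), p. 296] [cite: GrossLMS1991, §2 Prop. 2.1 (2)] [cite: Serre1972, §2.4 Prop. 15] [cite: Cremona2006, Table 1 (label 103581a1)] -/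
theorem bsdp_k103581a1_3 (hGZK : rank_eq_analyticRank_of_analyticRank_le_one) (W : WeierstrassCurve ℚ)
    (hW : W = ⟨1, -1, 0, -31407, 2150208⟩) {N : ℕ} [NeZero N] {K : Type} [Field K] [NumberField K]
    (hKo : kolyvagin N W K) (hB : Kolyvagin1990_padicValNat_card_sha_le N W K) (hK : IsImaginaryQuadratic K)
    (hH : SatisfiesHeegnerHypothesis N K) {P : (W.baseChange K).toAffine.Point} (hP : IsHeegnerPoint N W K P)
    (hnt : ¬ IsOfFinAddOrder P) (hI : ¬ 3 ∣ (AddSubgroup.zmultiples P).index) (hr : W.analyticRank ≤ 1)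
    {q : ℚ} (hq : shaAn W = (q : ℂ)) (hv : padicValRat 3 q = 0) : BSDp W 3 :=
  X11b.bsdp_three_of_kolyvaginIndex_of_irr_of_order 1 (-1) 0 (-31407) 2150208
    (Supersingular.isGloballyMinimal_of_krausCriterion₃_factored 1 (-1) 0 (-31407) 2150208 [(3, 3), (17, 1), (677, 1)] (by decide +kernel)
      (by intro t ht; fin_cases ht <;> norm_num) (by decide +kernel))
    7 73 (by norm_num) (by norm_num) (by decide) (by decide) (by decide) (by decide) (by decide +kernel) (by decide +kernel)
    (n₁ := 11) (n₂ := 75) (by decide +kernel) (by decide +kernel) (by decide) (by decide) (by decide) (by decide)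
    hGZK W hW hKo hB hK hH hP hnt hI hr hq hv

/-- **`BSD(E,3)` for `365490v1`** (cell `(365490v1, 3)`, class X4, rank 1; KOLYD grammar key `KOLY:365490v1@3`); `N = 365490 = 2·3^2·5·31·131`,
additive `I8*` at `3`, `r_an = 1`, `#E(ℚ)_tors = 1`, `∏c = 88`, `#Ш_an = 1`, Cremona galrep: no code at this prime (`ρ̄_{E,3}` onto); `|Δ| = ∏` over
`[(2, 11), (3, 14), (5, 2), (31, 2), (131, 1)]` (factored Kraus criterion, every disjunct decided). KOLY-shaped: `3 ∤ #E(ℚ)_tors·∏c·#Ш_an`; door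
`X11b.bsdp_three_of_kolyvaginIndex_of_irr_of_order` (the unit's GEN 35 kit, class-agnostic: Kolyvagin as printed, `3 ∤ [E(K):ℤy_K]` ⇒ `Ш(E/ℚ)[3] =
0`); displayed certificate line `hI : ¬ 3 ∣ [E(K):ℤP]`. Serre Prop-15 witnesses mod `3`: `(ℓ, #Ẽ(𝔽_ℓ))` = `(11, 14)` (`X² − aX + ℓ` root-free over
`𝔽₃`), `(19, 15)` (`ℓ ≡ 1`, `a ≡ 2 (mod 3)`, `9 ∤ #Ẽ`). Kurihara lane note of record: «additive p, r=1». State of record (referee A ROUND 983,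
`scratchA_A_state_after_x4gh_add3_onA2R977_fold.pkl`): class `residue`, 1 open cell(s), register empty. Other engine-1 fields tried (`D`: `m`
(`ord_3 m`)): `-119`: `m = 528` (`ord = 1`); `-959`: `m = 1056` (`ord = 1`). THIS UNIT'S DATUM (displayed, NOT re-computed here): DEEP FIELD `K =
ℚ(√-1511)` (`1511` = prime): **`m = [E(K):ℤy_K] = 880`, `ord_3 m = 0`** (`ρ = m²/4`, `L'(E,1) = 14.213607758`, `L(E^D,1) = 2.2294571544`, `ĥ(P) =
0.8253244382`; Cremona's generator) — engine 1 j293239 = engine 2 j294065: `m = 880` EQUAL (FAIL:p2_not_div_N,lattice_j_selfcheck, dev ≤ 6.1e-14)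
(engine 2's period-lattice self-check restored by the PARI third check j295414: dev_j ≤ 1.4033437280664936235 E-76); twist `E^D` (j294066): `N =
834457894290`, `#tors·∏c·#Ш_an = 1·176·25`, `ord_3 #Ш_an(E^D) = 0`, `ord_3 ∏c(E^D) = 0` (BSD-consistent). CONDITIONAL on every binder; per cell;
nothing booked by this file.
[cite: McCallumLMS1991, §1 Theorem (Kolyvagin), p. 296] [cite: GrossLMS1991, §2 Prop. 2.1 (2)] [cite: Serre1972, §2.4 Prop. 15] [cite: Cremona2006, Table 1 (label 365490v1)] -/
theorem bsdp_k365490v1_3 (hGZK : rank_eq_analyticRank_of_analyticRank_le_one) (W : WeierstrassCurve ℚ)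
    (hW : W = ⟨1, -1, 1, -215756303, 1219867200087⟩) {N : ℕ} [NeZero N] {K : Type} [Field K] [NumberField K]
    (hKo : kolyvagin N W K) (hB : Kolyvagin1990_padicValNat_card_sha_le N W K) (hK : IsImaginaryQuadratic K)
    (hH : SatisfiesHeegnerHypothesis N K) {P : (W.baseChange K).toAffine.Point} (hP : IsHeegnerPoint N W K P)
    (hnt : ¬ IsOfFinAddOrder P) (hI : ¬ 3 ∣ (AddSubgroup.zmultiples P).index) (hr : W.analyticRank ≤ 1)
    {q : ℚ} (hq : shaAn W = (q : ℂ)) (hv : padicValRat 3 q = 0) : BSDp W 3 :=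
  X11b.bsdp_three_of_kolyvaginIndex_of_irr_of_order 1 (-1) 1 (-215756303) 1219867200087
    (Supersingular.isGloballyMinimal_of_krausCriterion₃_factored 1 (-1) 1 (-215756303) 1219867200087 [(2, 11), (3, 14), (5, 2), (31, 2), (131, 1)] (by decide +kernel)
      (by intro t ht; fin_cases ht <;> norm_num) (by decide +kernel))
    11 19 (by norm_num) (by norm_num) (by decide) (by decide) (by decide) (by decide) (by decide +kernel) (by decide +kernel)
    (n₁ := 14) (n₂ := 15) (by decide +kernel) (by decide +kernel) (by decide) (by decide) (by decide) (by decide)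
    hGZK W hW hKo hB hK hH hP hnt hI hr hq hv

/-- **`BSD(E,3)` for `407358v1`** (cell `(407358v1, 3)`, class X4, rank 1; KOLYD grammar key `KOLY:407358v1@3`); `N = 407358 = 2·3^2·7·53·61`,
additive `I2*` at `3`, `r_an = 1`, `#E(ℚ)_tors = 2`, `∏c = 112`, `#Ш_an = 1`, Cremona galrep: no code at this prime (`ρ̄_{E,3}` onto); `|Δ| = ∏`
over `[(2, 28), (3, 8), (7, 2), (53, 1), (61, 1)]` (factored Kraus criterion, every disjunct decided). KOLY-shaped: `3 ∤ #E(ℚ)_tors·∏c·#Ш_an`; door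
`X11b.bsdp_three_of_kolyvaginIndex_of_irr_of_order` (the unit's GEN 35 kit, class-agnostic: Kolyvagin as printed, `3 ∤ [E(K):ℤy_K]` ⇒ `Ш(E/ℚ)[3] =
0`); displayed certificate line `hI : ¬ 3 ∣ [E(K):ℤP]`. Serre Prop-15 witnesses mod `3`: `(ℓ, #Ẽ(𝔽_ℓ))` = `(5, 8)` (`X² − aX + ℓ` root-free over
`𝔽₃`), `(157, 156)` (`ℓ ≡ 1`, `a ≡ 2 (mod 3)`, `9 ∤ #Ẽ`). Kurihara lane note of record: «additive p, r=1». State of record (referee A ROUND 983,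
`scratchA_A_state_after_x4gh_add3_onA2R977_fold.pkl`): class `residue`, 1 open cell(s), register empty. FLAG `opt-code-3` (Cremona optimality code
3; `ρ̄_{E,3}` onto forbids a `3`-isogeny in the class, so `ord_3` of the index is class-invariant; the reading stands if the optimal curve's Manin
constant is prime to `3`). Other engine-1 fields tried (`D`: `m` (`ord_3 m`)): `-1223`: `m = 672` (`ord = 1`). THIS UNIT'S DATUM (displayed, NOT
re-computed here): DEEP FIELD `K = ℚ(√-1895)` (`1895` = 5·379): **`m = [E(K):ℤy_K] = 224`, `ord_3 m = 0`** (`ρ = m²/4`, `L'(E,1) = 15.071232240`,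
`L(E^D,1) = 3.1068448184`, `ĥ(P) = 2.6606694705`; Cremona's generator) — engine 1 j293228 = engine 2 j293889: `m = 224` EQUAL (FAIL:p2_not_div_N,
dev ≤ 3.3e-15); twist `E^D` (j293892): `N = 1462832761950`, `#tors·∏c·#Ш_an = 2·448·4`, `ord_3 #Ш_an(E^D) = 0`, `ord_3 ∏c(E^D) = 0`
(BSD-consistent). CONDITIONAL on every binder; per cell; nothing booked by this file.
[cite: McCallumLMS1991, §1 Theorem (Kolyvagin), p. 296] [cite: GrossLMS1991, §2 Prop. 2.1 (2)] [cite: Serre1972, §2.4 Prop. 15] [cite: Cremona2006, Table 1 (label 407358v1)] -/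
theorem bsdp_k407358v1_3 (hGZK : rank_eq_analyticRank_of_analyticRank_le_one) (W : WeierstrassCurve ℚ)
    (hW : W = ⟨1, -1, 1, -316481, -63562543⟩) {N : ℕ} [NeZero N] {K : Type} [Field K] [NumberField K]
    (hKo : kolyvagin N W K) (hB : Kolyvagin1990_padicValNat_card_sha_le N W K) (hK : IsImaginaryQuadratic K)
    (hH : SatisfiesHeegnerHypothesis N K) {P : (W.baseChange K).toAffine.Point} (hP : IsHeegnerPoint N W K P)
    (hnt : ¬ IsOfFinAddOrder P) (hI : ¬ 3 ∣ (AddSubgroup.zmultiples P).index) (hr : W.analyticRank ≤ 1)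
    {q : ℚ} (hq : shaAn W = (q : ℂ)) (hv : padicValRat 3 q = 0) : BSDp W 3 :=
  X11b.bsdp_three_of_kolyvaginIndex_of_irr_of_order 1 (-1) 1 (-316481) (-63562543)
    (Supersingular.isGloballyMinimal_of_krausCriterion₃_factored 1 (-1) 1 (-316481) (-63562543) [(2, 28), (3, 8), (7, 2), (53, 1), (61, 1)] (by decide +kernel)
      (by intro t ht; fin_cases ht <;> norm_num) (by decide +kernel))
    5 157 (by norm_num) (by norm_num) (by decide) (by decide) (by decide) (by decide) (by decide +kernel) (by decide +kernel)
    (n₁ := 8) (n₂ := 156) (by decide +kernel) (by decide +kernel) (by decide) (by decide) (by decide) (by decide)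
    hGZK W hW hKo hB hK hH hP hnt hI hr hq hv

/-- **`BSD(E,3)` for `407682h1`** (cell `(407682h1, 3)`, class X4, rank 1; KOLYD grammar key `KOLY:407682h1@3`); `N = 407682 = 2·3^2·11·29·71`,
additive `I5*` at `3`, `r_an = 1`, `#E(ℚ)_tors = 1`, `∏c = 4`, `#Ш_an = 1`, Cremona galrep: no code at this prime (`ρ̄_{E,3}` onto); `|Δ| = ∏` over
`[(2, 5), (3, 11), (11, 1), (29, 1), (71, 5)]` (factored Kraus criterion, every disjunct decided). KOLY-shaped: `3 ∤ #E(ℚ)_tors·∏c·#Ш_an`; door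
`X11b.bsdp_three_of_kolyvaginIndex_of_irr_of_order` (the unit's GEN 35 kit, class-agnostic: Kolyvagin as printed, `3 ∤ [E(K):ℤy_K]` ⇒ `Ш(E/ℚ)[3] =
0`); displayed certificate line `hI : ¬ 3 ∣ [E(K):ℤP]`. Serre Prop-15 witnesses mod `3`: `(ℓ, #Ẽ(𝔽_ℓ))` = `(5, 7)` (`X² − aX + ℓ` root-free over
`𝔽₃`), `(61, 75)` (`ℓ ≡ 1`, `a ≡ 2 (mod 3)`, `9 ∤ #Ẽ`). Kurihara lane note of record: «additive p, r=1». State of record (referee A ROUND 983,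
`scratchA_A_state_after_x4gh_add3_onA2R977_fold.pkl`): class `residue`, 1 open cell(s), register empty. FLAG `opt-code-2` (Cremona optimality code
2; `ρ̄_{E,3}` onto forbids a `3`-isogeny in the class, so `ord_3` of the index is class-invariant; the reading stands if the optimal curve's Manin
constant is prime to `3`). Other engine-1 fields tried (`D`: `m` (`ord_3 m`)): `-239`: `m = 24` (`ord = 1`); `-695`: `m = 96` (`ord = 1`); `-1415`:
`m = 24` (`ord = 1`). THIS UNIT'S DATUM (displayed, NOT re-computed here): DEEP FIELD `K = ℚ(√-1559)` (`1559` = prime): **`m = [E(K):ℤy_K] = 8`,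
`ord_3 m = 0`** (`ρ = m²/4`, `L'(E,1) = 3.0649105171`, `L(E^D,1) = 0.0234694894`, `ĥ(P) = 4.0331736444`; Cremona's generator) — engine 1 j293234 =
engine 2 j294330: `m = 8` EQUAL (FAIL:p2_not_div_N, dev ≤ 7.5e-14); twist `E^D` (j294332): `N = 990863355042`, `#tors·∏c·#Ш_an = 1·4·1`, `ord_3
#Ш_an(E^D) = 0`, `ord_3 ∏c(E^D) = 0` (BSD-consistent). CONDITIONAL on every binder; per cell; nothing booked by this file.
[cite: McCallumLMS1991, §1 Theorem (Kolyvagin), p. 296] [cite: GrossLMS1991, §2 Prop. 2.1 (2)] [cite: Serre1972, §2.4 Prop. 15] [cite: Cremona2006, Table 1 (label 407682h1)] -/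
theorem bsdp_k407682h1_3 (hGZK : rank_eq_analyticRank_of_analyticRank_le_one) (W : WeierstrassCurve ℚ)
    (hW : W = ⟨1, -1, 0, -444015, -73483443⟩) {N : ℕ} [NeZero N] {K : Type} [Field K] [NumberField K]
    (hKo : kolyvagin N W K) (hB : Kolyvagin1990_padicValNat_card_sha_le N W K) (hK : IsImaginaryQuadratic K)
    (hH : SatisfiesHeegnerHypothesis N K) {P : (W.baseChange K).toAffine.Point} (hP : IsHeegnerPoint N W K P)
    (hnt : ¬ IsOfFinAddOrder P) (hI : ¬ 3 ∣ (AddSubgroup.zmultiples P).index) (hr : W.analyticRank ≤ 1)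
    {q : ℚ} (hq : shaAn W = (q : ℂ)) (hv : padicValRat 3 q = 0) : BSDp W 3 :=
  X11b.bsdp_three_of_kolyvaginIndex_of_irr_of_order 1 (-1) 0 (-444015) (-73483443)
    (Supersingular.isGloballyMinimal_of_krausCriterion₃_factored 1 (-1) 0 (-444015) (-73483443) [(2, 5), (3, 11), (11, 1), (29, 1), (71, 5)] (by decide +kernel)
      (by intro t ht; fin_cases ht <;> norm_num) (by decide +kernel))
    5 61 (by norm_num) (by norm_num) (by decide) (by decide) (by decide) (by decide) (by decide +kernel) (by decide +kernel)
    (n₁ := 7) (n₂ := 75) (by decide +kernel) (by decide +kernel) (by decide) (by decide) (by decide) (by decide)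
    hGZK W hW hKo hB hK hH hP hnt hI hr hq hv

/-- **`BSD(E,3)` for `427635c1`** (cell `(427635c1, 3)`, class X4, rank 1; KOLYD grammar key `KOLY:427635c1@3`); `N = 427635 = 3^2·5·13·17·43`,
additive `I16*` at `3`, `r_an = 1`, `#E(ℚ)_tors = 2`, `∏c = 8`, `#Ш_an = 1`, Cremona galrep: no code at this prime (`ρ̄_{E,3}` onto); `|Δ| = ∏` over
`[(3, 22), (5, 2), (13, 1), (17, 1), (43, 1)]` (factored Kraus criterion, every disjunct decided). KOLY-shaped: `3 ∤ #E(ℚ)_tors·∏c·#Ш_an`; door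
`X11b.bsdp_three_of_kolyvaginIndex_of_irr_of_order` (the unit's GEN 35 kit, class-agnostic: Kolyvagin as printed, `3 ∤ [E(K):ℤy_K]` ⇒ `Ш(E/ℚ)[3] =
0`); displayed certificate line `hI : ¬ 3 ∣ [E(K):ℤP]`. Serre Prop-15 witnesses mod `3`: `(ℓ, #Ẽ(𝔽_ℓ))` = `(7, 8)` (`X² − aX + ℓ` root-free over
`𝔽₃`), `(19, 24)` (`ℓ ≡ 1`, `a ≡ 2 (mod 3)`, `9 ∤ #Ẽ`). Kurihara lane note of record: «additive p, r=1». State of record (referee A ROUND 983,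
`scratchA_A_state_after_x4gh_add3_onA2R977_fold.pkl`): class `residue`, 1 open cell(s), register empty. FLAG `opt-code-3` (Cremona optimality code
3; `ρ̄_{E,3}` onto forbids a `3`-isogeny in the class, so `ord_3` of the index is class-invariant; the reading stands if the optimal curve's Manin
constant is prime to `3`). Other engine-1 fields tried (`D`: `m` (`ord_3 m`)): `-536`: `m = 48` (`ord = 1`). THIS UNIT'S DATUM (displayed, NOT
re-computed here): DEEP FIELD `K = ℚ(√-1379)` (`1379` = 7·197): **`m = [E(K):ℤy_K] = 32`, `ord_3 m = 0`** (`ρ = m²/4`, `L'(E,1) = 4.0212954149`,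
`L(E^D,1) = 2.0608182995`, `ĥ(P) = 9.5263658629`; Cremona's generator) — engine 1 j293239 = engine 2 j294065: `m = 32` EQUAL (FAIL:p2_not_div_N, dev
≤ 8.1e-14); twist `E^D` (j294066): `N = 813208249035`, `#tors·∏c·#Ш_an = 2·64·16`, `ord_3 #Ш_an(E^D) = 0`, `ord_3 ∏c(E^D) = 0` (BSD-consistent).
CONDITIONAL on every binder; per cell; nothing booked by this file.
[cite: McCallumLMS1991, §1 Theorem (Kolyvagin), p. 296] [cite: GrossLMS1991, §2 Prop. 2.1 (2)] [cite: Serre1972, §2.4 Prop. 15] [cite: Cremona2006, Table 1 (label 427635c1)] -/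
theorem bsdp_k427635c1_3 (hGZK : rank_eq_analyticRank_of_analyticRank_le_one) (W : WeierstrassCurve ℚ)
    (hW : W = ⟨1, -1, 1, 24862, -3876744⟩) {N : ℕ} [NeZero N] {K : Type} [Field K] [NumberField K]
    (hKo : kolyvagin N W K) (hB : Kolyvagin1990_padicValNat_card_sha_le N W K) (hK : IsImaginaryQuadratic K)
    (hH : SatisfiesHeegnerHypothesis N K) {P : (W.baseChange K).toAffine.Point} (hP : IsHeegnerPoint N W K P)
    (hnt : ¬ IsOfFinAddOrder P) (hI : ¬ 3 ∣ (AddSubgroup.zmultiples P).index) (hr : W.analyticRank ≤ 1)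
    {q : ℚ} (hq : shaAn W = (q : ℂ)) (hv : padicValRat 3 q = 0) : BSDp W 3 :=
  X11b.bsdp_three_of_kolyvaginIndex_of_irr_of_order 1 (-1) 1 24862 (-3876744)
    (Supersingular.isGloballyMinimal_of_krausCriterion₃_factored 1 (-1) 1 24862 (-3876744) [(3, 22), (5, 2), (13, 1), (17, 1), (43, 1)] (by decide +kernel)
      (by intro t ht; fin_cases ht <;> norm_num) (by decide +kernel))
    7 19 (by norm_num) (by norm_num) (by decide) (by decide) (by decide) (by decide) (by decide +kernel) (by decide +kernel)
    (n₁ := 8) (n₂ := 24) (by decide +kernel) (by decide +kernel) (by decide) (by decide) (by decide) (by decide)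
    hGZK W hW hKo hB hK hH hP hnt hI hr hq hv

/-- **`BSD(E,3)` for `491040bf1`** (cell `(491040bf1, 3)`, class X4, rank 1; KOLYD grammar key `KOLY:491040bf1@3`); `N = 491040 = 2^5·3^2·5·11·31`,
additive `I2*` at `3`, `r_an = 1`, `#E(ℚ)_tors = 4`, `∏c = 128`, `#Ш_an = 1`, Cremona galrep: no code at this prime (`ρ̄_{E,3}` onto); `|Δ| = ∏`
over `[(2, 6), (3, 8), (5, 8), (11, 4), (31, 2)]` (factored Kraus criterion, every disjunct decided). KOLY-shaped: `3 ∤ #E(ℚ)_tors·∏c·#Ш_an`; door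
`X11b.bsdp_three_of_kolyvaginIndex_of_irr_of_order` (the unit's GEN 35 kit, class-agnostic: Kolyvagin as printed, `3 ∤ [E(K):ℤy_K]` ⇒ `Ш(E/ℚ)[3] =
0`); displayed certificate line `hI : ¬ 3 ∣ [E(K):ℤP]`. Serre Prop-15 witnesses mod `3`: `(ℓ, #Ẽ(𝔽_ℓ))` = `(7, 8)` (`X² − aX + ℓ` root-free over
`𝔽₃`), `(151, 168)` (`ℓ ≡ 1`, `a ≡ 2 (mod 3)`, `9 ∤ #Ẽ`). Kurihara lane note of record: «additive p, r=1». State of record (referee A ROUND 983,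
`scratchA_A_state_after_x4gh_add3_onA2R977_fold.pkl`): class `residue`, 1 open cell(s), register empty. FLAG `opt-code-2` (Cremona optimality code
2; `ρ̄_{E,3}` onto forbids a `3`-isogeny in the class, so `ord_3` of the index is class-invariant; the reading stands if the optimal curve's Manin
constant is prime to `3`). Other engine-1 fields tried (`D`: `m` (`ord_3 m`)): `-239`: `m = 192` (`ord = 1`); `-959`: `m = 192` (`ord = 1`). THIS
UNIT'S DATUM (displayed, NOT re-computed here): DEEP FIELD `K = ℚ(√-2351)` (`2351` = prime): **`m = [E(K):ℤy_K] = 128`, `ord_3 m = 0`** (`ρ = m²/4`,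
`L'(E,1) = 5.0519122048`, `L(E^D,1) = 0.6254870232`, `ĥ(P) = 3.0441088546`; Cremona's generator) — engine 1 j293234 = engine 2 j294330: `m = 128`
EQUAL (FAIL:p2_not_div_N, dev ≤ 8.2e-14); twist `E^D` (j294332): `N = 2714076779040`, `#tors·∏c·#Ш_an = 4·512·16`, `ord_3 #Ш_an(E^D) = 0`, `ord_3
∏c(E^D) = 0` (BSD-consistent). CONDITIONAL on every binder; per cell; nothing booked by this file.
[cite: McCallumLMS1991, §1 Theorem (Kolyvagin), p. 296] [cite: GrossLMS1991, §2 Prop. 2.1 (2)] [cite: Serre1972, §2.4 Prop. 15] [cite: Cremona2006, Table 1 (label 491040bf1)] -/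
theorem bsdp_k491040bf1_3 (hGZK : rank_eq_analyticRank_of_analyticRank_le_one) (W : WeierstrassCurve ℚ)
    (hW : W = ⟨0, 0, 0, -42198753, 105510926248⟩) {N : ℕ} [NeZero N] {K : Type} [Field K] [NumberField K]
    (hKo : kolyvagin N W K) (hB : Kolyvagin1990_padicValNat_card_sha_le N W K) (hK : IsImaginaryQuadratic K)
    (hH : SatisfiesHeegnerHypothesis N K) {P : (W.baseChange K).toAffine.Point} (hP : IsHeegnerPoint N W K P)
    (hnt : ¬ IsOfFinAddOrder P) (hI : ¬ 3 ∣ (AddSubgroup.zmultiples P).index) (hr : W.analyticRank ≤ 1)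
    {q : ℚ} (hq : shaAn W = (q : ℂ)) (hv : padicValRat 3 q = 0) : BSDp W 3 :=
  X11b.bsdp_three_of_kolyvaginIndex_of_irr_of_order 0 0 0 (-42198753) 105510926248
    (Supersingular.isGloballyMinimal_of_krausCriterion₃_factored 0 0 0 (-42198753) 105510926248 [(2, 6), (3, 8), (5, 8), (11, 4), (31, 2)] (by decide +kernel)
      (by intro t ht; fin_cases ht <;> norm_num) (by decide +kernel))
    7 151 (by norm_num) (by norm_num) (by decide) (by decide) (by decide) (by decide) (by decide +kernel) (by decide +kernel)
    (n₁ := 8) (n₂ := 168) (by decide +kernel) (by decide +kernel) (by decide) (by decide) (by decide) (by decide)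
    hGZK W hW hKo hB hK hH hP hnt hI hr hq hv

/-- **`BSD(E,3)` for `194400cd1`** (cell `(194400cd1, 3)`, class X4, rank 0; KOLYD grammar key `KOLY:194400cd1@3`); `N = 194400 = 2^5·3^5·5^2`,
additive `II*` at `3`, `r_an = 0`, `#E(ℚ)_tors = 1`, `∏c = 1`, `#Ш_an = 25`, Cremona galrep: no code at this prime (`ρ̄_{E,3}` onto); `|Δ| = ∏` over
`[(2, 9), (3, 13), (5, 6)]` (factored Kraus criterion, every disjunct decided). KOLY-shaped: `3 ∤ #E(ℚ)_tors·∏c·#Ш_an`; door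
`X11b.bsdp_three_of_kolyvaginIndex_of_irr_of_order` (the unit's GEN 35 kit, class-agnostic: Kolyvagin as printed, `3 ∤ [E(K):ℤy_K]` ⇒ `Ш(E/ℚ)[3] =
0`); displayed certificate line `hI : ¬ 3 ∣ [E(K):ℤP]`. Serre Prop-15 witnesses mod `3`: `(ℓ, #Ẽ(𝔽_ℓ))` = `(11, 14)` (`X² − aX + ℓ` root-free over
`𝔽₃`), `(13, 12)` (`ℓ ≡ 1`, `a ≡ 2 (mod 3)`, `9 ∤ #Ẽ`). Kurihara lane note of record: «additive p, irreducible». State of record (referee A ROUND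
983, `scratchA_A_state_after_x4gh_add3_onA2R977_fold.pkl`): class `residue`, 1 open cell(s), register empty. Other engine-1 fields tried (`D`: `m`
(`ord_3 m`)): none. THIS UNIT'S DATUM (displayed, NOT re-computed here): DEEP FIELD `K = ℚ(√-1271)` (`1271` = 31·41): rank-one twist `F = E^D` (`N_F
= 314041730400`), point `x` on `F` by ellrank0 (saturated at the primes `< 100`), **`m = [E(K):ℤy_K] = 20`, `ord_3 m = 0`** (`ρ = m²/4`, `L(E,1) =
3.5904921378`, `L'(F,1) = 2.9569475645`, `ĥ(x) = 49.099774318`) — engine 1 j293870 = engine 2 j294269: `m = 20` EQUAL (FAIL:p2_not_div_N, dev ≤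
5.3e-14); twist `E^D` (j294272): `N = 314041730400`, `#tors·∏c·#Ш_an = 1·4·1`, `ord_3 #Ш_an(E^D) = 0`, `ord_3 ∏c(E^D) = 0` (BSD-consistent).
CONDITIONAL on every binder; per cell; nothing booked by this file.
[cite: McCallumLMS1991, §1 Theorem (Kolyvagin), p. 296] [cite: GrossLMS1991, §2 Prop. 2.1 (2)] [cite: Serre1972, §2.4 Prop. 15] [cite: Cremona2006, Table 1 (label 194400cd1)] -/
theorem bsdp_k194400cd1_3 (hGZK : rank_eq_analyticRank_of_analyticRank_le_one) (W : WeierstrassCurve ℚ)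
    (hW : W = ⟨0, 0, 0, -1221075, -519351750⟩) {N : ℕ} [NeZero N] {K : Type} [Field K] [NumberField K]
    (hKo : kolyvagin N W K) (hB : Kolyvagin1990_padicValNat_card_sha_le N W K) (hK : IsImaginaryQuadratic K)
    (hH : SatisfiesHeegnerHypothesis N K) {P : (W.baseChange K).toAffine.Point} (hP : IsHeegnerPoint N W K P)
    (hnt : ¬ IsOfFinAddOrder P) (hI : ¬ 3 ∣ (AddSubgroup.zmultiples P).index) (hr : W.analyticRank ≤ 1)
    {q : ℚ} (hq : shaAn W = (q : ℂ)) (hv : padicValRat 3 q = 0) : BSDp W 3 :=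
  X11b.bsdp_three_of_kolyvaginIndex_of_irr_of_order 0 0 0 (-1221075) (-519351750)
    (Supersingular.isGloballyMinimal_of_krausCriterion₃_factored 0 0 0 (-1221075) (-519351750) [(2, 9), (3, 13), (5, 6)] (by decide +kernel)
      (by intro t ht; fin_cases ht <;> norm_num) (by decide +kernel))
    11 13 (by norm_num) (by norm_num) (by decide) (by decide) (by decide) (by decide) (by decide +kernel) (by decide +kernel)
    (n₁ := 14) (n₂ := 12) (by decide +kernel) (by decide +kernel) (by decide) (by decide) (by decide) (by decide)
    hGZK W hW hKo hB hK hH hP hnt hI hr hq hv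

end Summit.BirchSwinnertonDyer.Rank1Residual.X4

end
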